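import Mathlib
import Literature.Analysis.FluidPDE.VectorCalculus
import Literature.Analysis.FluidPDE.TaoAveragedNondegeneracy
import Literature.Analysis.FluidPDE.LeiZhang2011Proofs

/-!
# Radial monotonicity of equilibrium filaments outside the velocity ball
(helper for the registered stub `stub_lengthRegular` of crux `FilamentSkeletonRss.SkeletonEquilibrium`,
stmt-NavierStokesRegularity-15400; the SC-free conjunct `LengthRegular` shared by the three negation lines
`kelvin-sonic-negation`, `mirror-point-negation`, `zero-accretion-selection`)

Setting: one filament `Ξ : ℝ → ℝ³` of a relative equilibrium in the rotating Leray frame,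
`u(τ) + ½ Ξ(τ) − α e₃ × Ξ(τ) = w(τ) Ξ′(τ)`, unit speed, proper at both ends, where `u(τ)` (the skeleton's
regularised Biot–Savart velocity at `Ξ(τ)`, kept ABSTRACT here) is bounded along the filament, `‖u(τ)‖ ≤ U`.
NO stagnation / unique-zero clause is used (the stub `stub_lengthRegular` has none) — this is the two-sided,
quantitative version of the one-sided sign lemma `ZeroAccretionSelection.inner_tangent_pos_of_slip_pos`
(`…RadialEndTools`, which needs `0 < w`).

Results (sorry-free):
* `norm_le_mul_abs_inner` — pointwise: `4U ≤ ‖Ξ‖ ⇒ ‖Ξ‖ ≤ (3 + 4|α|)·|⟪T, Ξ⟫|`;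
* `abs_deriv_norm_ge` — hence `|d‖Ξ‖/dτ| ≥ (3 + 4|α|)⁻¹` outside the velocity ball `‖Ξ‖ ≤ 4U`;
* `norm_le_of_between`, `exists_norm_le` — `{τ | ‖Ξ τ‖ ≤ 4U}` is a NONEMPTY INTERVAL (no interior radial
  critical point outside the velocity ball; the global radial minimum lies inside it);
* `right_branch_growth` / `left_branch_growth` — on the two outer branches `‖Ξ‖` is strictly monotone with
  rate `≥ (3 + 4|α|)⁻¹` ("proper ends cross each shell once" — the structural input the stub's docstring cites),
  via Darboux's theorem and properness; `reversal` — time reversal of the tangency relation.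
The length bounds built on this are in `…LengthRegularOuter`. No summit statement is proved; NS regularity is
not touched.
-/

noncomputable section

open Set Filter Topology MeasureTheory
open Literature.Analysis.FluidPDE Literature.Analysis.FluidPDE.Tao2016
open scoped RealInnerProductSpace InnerProductSpace

namespace Summit.NavierStokesRegularity.NavierStokesRegularity.Theorems.SkeletonEquilibrium.LengthRegular
set_option linter.dupNamespace false

/-! ## Pointwise radial slip bound (two-sided, SC-free) -/

/-- **Two-sided radial slip bound.** If `u + ½Ξ − α e₃×Ξ = w T` with `‖T‖ = 1`, `‖u‖ ≤ U` and
`4U ≤ ‖Ξ‖`, then `‖Ξ‖ ≤ (3 + 4|α|)·|⟪T, Ξ⟫|`: outside the velocity ball the filament is transversal to the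
spheres `‖y‖ = const`, quantitatively (pair the relation with `Ξ`: `w⟪T,Ξ⟫ = ⟪u,Ξ⟫ + ½‖Ξ‖² ≥ ¼‖Ξ‖²`, and
`|w| ≤ U + (½+|α|)‖Ξ‖ ≤ (¾+|α|)‖Ξ‖`). [folklore] -/
theorem norm_le_mul_abs_inner (α w U : ℝ) (u Ξ T : EuclideanSpace ℝ (Fin 3))
    (h : u + (1 / 2 : ℝ) • Ξ - α • cross (EuclideanSpace.single (2 : Fin 3) (1 : ℝ)) Ξ = w • T)
    (hT : ‖T‖ = 1) (hu : ‖u‖ ≤ U) (hΞ : 4 * U ≤ ‖Ξ‖) :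
    ‖Ξ‖ ≤ (3 + 4 * |α|) * |⟪T, Ξ⟫| := by
  -- radial identity `w ⟪T, Ξ⟫ = ⟪u, Ξ⟫ + ½‖Ξ‖²` (the rotation is orthogonal to `Ξ`;
  -- cf. `ZeroAccretionSelection.slip_mul_inner_eq` in `…RadialEndTools`)
  have hid : w * ⟪T, Ξ⟫ = ⟪u, Ξ⟫ + 1 / 2 * ‖Ξ‖ ^ 2 := by
    have := congrArg (fun v => ⟪v, Ξ⟫) h
    simp only [inner_add_left, inner_sub_left, real_inner_smul_left, inner_cross_self_right,
      mul_zero, sub_zero, real_inner_self_eq_norm_sq] at this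
    linarith
  have hcs : |⟪u, Ξ⟫| ≤ ‖u‖ * ‖Ξ‖ := abs_real_inner_le_norm u Ξ
  have hg0 : 0 ≤ ‖Ξ‖ := norm_nonneg _
  have h1 : ‖u‖ * ‖Ξ‖ ≤ U * ‖Ξ‖ := mul_le_mul_of_nonneg_right hu hg0
  have h2 : 1 / 4 * ‖Ξ‖ ^ 2 ≤ w * ⟪T, Ξ⟫ := by
    rw [hid]
    have := neg_abs_le ⟪u, Ξ⟫
    nlinarith
  -- slip bound `|w| ≤ U + (½ + |α|)‖Ξ‖ ≤ (¾ + |α|)‖Ξ‖`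
  have hcr : ‖cross (EuclideanSpace.single (2 : Fin 3) (1 : ℝ)) Ξ‖ ≤ ‖Ξ‖ := by
    have := norm_cross_le_norm_mul_norm (EuclideanSpace.single (2 : Fin 3) (1 : ℝ)) Ξ
    have he : ‖(EuclideanSpace.single (2 : Fin 3) (1 : ℝ))‖ = 1 := by simp
    rwa [he, one_mul] at this
  have hw : |w| ≤ (3 / 4 + |α|) * ‖Ξ‖ := by
    have e1 : |w| = ‖w • T‖ := by rw [norm_smul, Real.norm_eq_abs, hT, mul_one]
    rw [e1, ← h]
    calc ‖u + (1 / 2 : ℝ) • Ξ - α • cross (EuclideanSpace.single (2 : Fin 3) (1 : ℝ)) Ξ‖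
        ≤ ‖u + (1 / 2 : ℝ) • Ξ‖ + ‖α • cross (EuclideanSpace.single (2 : Fin 3) (1 : ℝ)) Ξ‖ :=
          norm_sub_le _ _
      _ ≤ (‖u‖ + ‖(1 / 2 : ℝ) • Ξ‖) + ‖α • cross (EuclideanSpace.single (2 : Fin 3) (1 : ℝ)) Ξ‖ := by
          gcongr; exact norm_add_le _ _
      _ = ‖u‖ + 1 / 2 * ‖Ξ‖ + |α| * ‖cross (EuclideanSpace.single (2 : Fin 3) (1 : ℝ)) Ξ‖ := by
          rw [norm_smul, norm_smul, Real.norm_eq_abs, Real.norm_eq_abs,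
            abs_of_pos (by norm_num : (0:ℝ) < 1 / 2)]
      _ ≤ U + 1 / 2 * ‖Ξ‖ + |α| * ‖Ξ‖ := by gcongr
      _ ≤ (3 / 4 + |α|) * ‖Ξ‖ := by nlinarith [abs_nonneg α]
  have h3 : w * ⟪T, Ξ⟫ ≤ |w| * |⟪T, Ξ⟫| := by
    rw [← abs_mul]; exact le_abs_self _
  have h4 : 1 / 4 * ‖Ξ‖ ^ 2 ≤ (3 / 4 + |α|) * ‖Ξ‖ * |⟪T, Ξ⟫| := by
    have := mul_le_mul_of_nonneg_right hw (abs_nonneg ⟪T, Ξ⟫)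
    linarith
  rcases eq_or_lt_of_le hg0 with hz | hpos
  · rw [← hz]; positivity
  · have h5 : 1 / 4 * ‖Ξ‖ ≤ (3 / 4 + |α|) * |⟪T, Ξ⟫| := by
      have : 1 / 4 * ‖Ξ‖ * ‖Ξ‖ ≤ ((3 / 4 + |α|) * |⟪T, Ξ⟫|) * ‖Ξ‖ := by nlinarith
      exact le_of_mul_le_mul_right this hpos
    linarith

/-! ## The radial function along a filament -/

/-- Derivative of `τ ↦ ‖Ξ τ‖` away from the origin: `⟪Ξ, Ξ′⟫ / ‖Ξ‖`. [folklore] -/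
theorem hasDerivAt_norm_curve {Ξ : ℝ → EuclideanSpace ℝ (Fin 3)} (hΞ : Differentiable ℝ Ξ) {τ : ℝ}
    (h0 : Ξ τ ≠ 0) : HasDerivAt (fun s => ‖Ξ s‖) (⟪Ξ τ, deriv Ξ τ⟫ / ‖Ξ τ‖) τ := by
  have h1 : HasDerivAt (fun s => ‖Ξ s‖ ^ 2) (⟪Ξ τ, deriv Ξ τ⟫ + ⟪deriv Ξ τ, Ξ τ⟫) τ := by
    have := (hΞ τ).hasDerivAt.inner ℝ (hΞ τ).hasDerivAt
    simpa only [real_inner_self_eq_norm_sq] using this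
  have hn : 0 < ‖Ξ τ‖ := norm_pos_iff.2 h0
  have hne : ‖Ξ τ‖ ^ 2 ≠ 0 := by positivity
  have h2 := h1.sqrt hne
  have e : (fun s => Real.sqrt (‖Ξ s‖ ^ 2)) = fun s => ‖Ξ s‖ := by
    funext s; rw [Real.sqrt_sq (norm_nonneg _)]
  rw [e] at h2
  convert h2 using 1
  rw [Real.sqrt_sq (norm_nonneg _), real_inner_comm (deriv Ξ τ)]
  field_simp
  ring

/-- **Transversality to spheres outside the velocity ball.** Under the tangency relation with `‖Ξ′‖ = 1`
and `‖u‖ ≤ U`, at every parameter with `4U ≤ ‖Ξ τ‖` and `Ξ τ ≠ 0` the radial function `‖Ξ‖` is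
differentiable with `|d‖Ξ‖/dτ| ≥ (3 + 4|α|)⁻¹`. [folklore] -/
theorem abs_deriv_norm_ge {Ξ u : ℝ → EuclideanSpace ℝ (Fin 3)} {w : ℝ → ℝ} {α U : ℝ}
    (hΞ : Differentiable ℝ Ξ) (hT : ∀ τ, ‖deriv Ξ τ‖ = 1)
    (heq : ∀ τ, u τ + (1 / 2 : ℝ) • Ξ τ - α • cross (EuclideanSpace.single (2 : Fin 3) (1 : ℝ)) (Ξ τ)
      = w τ • deriv Ξ τ)
    (hu : ∀ τ, ‖u τ‖ ≤ U) {τ : ℝ} (h4 : 4 * U ≤ ‖Ξ τ‖) (h0 : Ξ τ ≠ 0) :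
    (3 + 4 * |α|)⁻¹ ≤ |deriv (fun s => ‖Ξ s‖) τ| := by
  rw [(hasDerivAt_norm_curve hΞ h0).deriv]
  have hn : 0 < ‖Ξ τ‖ := norm_pos_iff.2 h0
  have hkey := norm_le_mul_abs_inner α (w τ) U (u τ) (Ξ τ) (deriv Ξ τ) (heq τ) (hT τ) (hu τ) h4
  rw [real_inner_comm] at hkey
  have hc : 0 < 3 + 4 * |α| := by positivity
  rw [abs_div, abs_of_pos hn, le_div_iff₀ hn, inv_mul_le_iff₀ hc]
  exact hkey

/-! ## The velocity ball is crossed once: `{‖Ξ‖ ≤ 4U}` is an interval -/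

/-- **No interior radial maximum outside the velocity ball**: if `‖Ξ τ₁‖ ≤ 4U` and `‖Ξ τ₂‖ ≤ 4U` then
`‖Ξ τ‖ ≤ 4U` for every `τ` between them — the set `{τ | ‖Ξ τ‖ ≤ 4U}` is order-connected. (A maximum of
`‖Ξ‖` on `[τ₁, τ₂]` above `4U` would be an interior critical point of `‖Ξ‖`, impossible by
`abs_deriv_norm_ge`.) [folklore] -/
theorem norm_le_of_between {Ξ u : ℝ → EuclideanSpace ℝ (Fin 3)} {w : ℝ → ℝ} {α U : ℝ}
    (hΞ : Differentiable ℝ Ξ) (hT : ∀ τ, ‖deriv Ξ τ‖ = 1)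
    (heq : ∀ τ, u τ + (1 / 2 : ℝ) • Ξ τ - α • cross (EuclideanSpace.single (2 : Fin 3) (1 : ℝ)) (Ξ τ)
      = w τ • deriv Ξ τ)
    (hu : ∀ τ, ‖u τ‖ ≤ U) {τ₁ τ τ₂ : ℝ} (h₁ : τ₁ ≤ τ) (h₂ : τ ≤ τ₂)
    (hτ₁ : ‖Ξ τ₁‖ ≤ 4 * U) (hτ₂ : ‖Ξ τ₂‖ ≤ 4 * U) : ‖Ξ τ‖ ≤ 4 * U := by
  by_contra hgt
  push Not at hgt
  have hU0 : 0 ≤ U := le_trans (norm_nonneg _) (hu τ)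
  have hcont : ContinuousOn (fun s => ‖Ξ s‖) (Icc τ₁ τ₂) := (hΞ.continuous.norm).continuousOn
  obtain ⟨τ₀, hτ₀, hmax⟩ := isCompact_Icc.exists_isMaxOn ⟨τ, h₁, h₂⟩ hcont
  have hge : ‖Ξ τ‖ ≤ ‖Ξ τ₀‖ := hmax ⟨h₁, h₂⟩
  have hgt₀ : 4 * U < ‖Ξ τ₀‖ := lt_of_lt_of_le hgt hge
  have hne₁ : τ₀ ≠ τ₁ := fun h => by rw [h] at hgt₀; linarith
  have hne₂ : τ₀ ≠ τ₂ := fun h => by rw [h] at hgt₀; linarith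
  have hlo : τ₁ < τ₀ := lt_of_le_of_ne hτ₀.1 (Ne.symm hne₁)
  have hhi : τ₀ < τ₂ := lt_of_le_of_ne hτ₀.2 hne₂
  have hloc : IsLocalMax (fun s => ‖Ξ s‖) τ₀ :=
    hmax.isLocalMax (Icc_mem_nhds hlo hhi)
  have h0 : Ξ τ₀ ≠ 0 := by
    intro h; rw [h, norm_zero] at hgt₀; linarith
  have hz := hloc.hasDerivAt_eq_zero (hasDerivAt_norm_curve hΞ h0)
  have hb := abs_deriv_norm_ge hΞ hT heq hu hgt₀.le h0
  rw [(hasDerivAt_norm_curve hΞ h0).deriv, hz, abs_zero] at hb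
  have : (0 : ℝ) < (3 + 4 * |α|)⁻¹ := by positivity
  linarith

/-- **The velocity ball is visited**: a proper filament (‖Ξ‖ → ∞ at both ends) has a parameter with
`‖Ξ τ‖ ≤ 4U` (its global radial minimum is a critical point of `‖Ξ‖`, hence inside the velocity ball, or
the origin itself). [folklore] -/
theorem exists_norm_le {Ξ u : ℝ → EuclideanSpace ℝ (Fin 3)} {w : ℝ → ℝ} {α U : ℝ}
    (hΞ : Differentiable ℝ Ξ) (hT : ∀ τ, ‖deriv Ξ τ‖ = 1)
    (heq : ∀ τ, u τ + (1 / 2 : ℝ) • Ξ τ - α • cross (EuclideanSpace.single (2 : Fin 3) (1 : ℝ)) (Ξ τ)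
      = w τ • deriv Ξ τ)
    (hu : ∀ τ, ‖u τ‖ ≤ U) (htop : Tendsto (fun τ => ‖Ξ τ‖) atTop atTop)
    (hbot : Tendsto (fun τ => ‖Ξ τ‖) atBot atTop) : ∃ τ, ‖Ξ τ‖ ≤ 4 * U := by
  have hcont : Continuous (fun s => ‖Ξ s‖) := hΞ.continuous.norm
  have hco : Tendsto (fun τ => ‖Ξ τ‖) (cocompact ℝ) atTop := by
    rw [cocompact_eq_atBot_atTop]; exact tendsto_sup.2 ⟨hbot, htop⟩
  obtain ⟨τm, hmin⟩ := hcont.exists_forall_le hco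
  refine ⟨τm, ?_⟩
  by_contra hgt
  push Not at hgt
  have hU0 : 0 ≤ U := le_trans (norm_nonneg _) (hu τm)
  have h0 : Ξ τm ≠ 0 := by
    intro h; rw [h, norm_zero] at hgt; linarith
  have hloc : IsLocalMin (fun s => ‖Ξ s‖) τm :=
    Filter.Eventually.of_forall fun y => hmin y
  have hz := hloc.hasDerivAt_eq_zero (hasDerivAt_norm_curve hΞ h0)
  have hb := abs_deriv_norm_ge hΞ hT heq hu hgt.le h0
  rw [(hasDerivAt_norm_curve hΞ h0).deriv, hz, abs_zero] at hb
  have : (0 : ℝ) < (3 + 4 * |α|)⁻¹ := by positivity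
  linarith

/-! ## The outer branches: strict radial monotonicity with a rate -/

/-- The right outer branch beyond a point `s₀` of the velocity ball is an up-set: if `s₀ ≤ τ₁`,
`4U < ‖Ξ τ₁‖` and `τ₁ ≤ τ`, then `4U < ‖Ξ τ‖`. [folklore] -/
theorem right_branch_up {Ξ u : ℝ → EuclideanSpace ℝ (Fin 3)} {w : ℝ → ℝ} {α U : ℝ}
    (hΞ : Differentiable ℝ Ξ) (hT : ∀ τ, ‖deriv Ξ τ‖ = 1)
    (heq : ∀ τ, u τ + (1 / 2 : ℝ) • Ξ τ - α • cross (EuclideanSpace.single (2 : Fin 3) (1 : ℝ)) (Ξ τ)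
      = w τ • deriv Ξ τ)
    (hu : ∀ τ, ‖u τ‖ ≤ U) {s₀ τ₁ τ : ℝ} (hs₀ : ‖Ξ s₀‖ ≤ 4 * U) (h₀₁ : s₀ ≤ τ₁)
    (hτ₁ : 4 * U < ‖Ξ τ₁‖) (h₁ : τ₁ ≤ τ) : 4 * U < ‖Ξ τ‖ := by
  by_contra hle
  push Not at hle
  have := norm_le_of_between hΞ hT heq hu h₀₁ h₁ hs₀ hle
  linarith

/-- **Right branch growth.** Beyond a point `s₀` of the velocity ball, on the set
`R = {τ | s₀ ≤ τ ∧ 4U < ‖Ξ τ‖}` the radial function increases at rate `≥ (3 + 4|α|)⁻¹`: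
`(3 + 4|α|)⁻¹ (τ₂ − τ₁) ≤ ‖Ξ τ₂‖ − ‖Ξ τ₁‖` for `τ₁ ≤ τ₂` in `R`. (Darboux: the nonvanishing derivative of
`‖Ξ‖` has constant sign on the interval `R`; a negative sign contradicts properness.) [folklore] -/
theorem right_branch_growth {Ξ u : ℝ → EuclideanSpace ℝ (Fin 3)} {w : ℝ → ℝ} {α U : ℝ}
    (hΞ : Differentiable ℝ Ξ) (hT : ∀ τ, ‖deriv Ξ τ‖ = 1)
    (heq : ∀ τ, u τ + (1 / 2 : ℝ) • Ξ τ - α • cross (EuclideanSpace.single (2 : Fin 3) (1 : ℝ)) (Ξ τ)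
      = w τ • deriv Ξ τ)
    (hu : ∀ τ, ‖u τ‖ ≤ U) (htop : Tendsto (fun τ => ‖Ξ τ‖) atTop atTop)
    {s₀ : ℝ} (hs₀ : ‖Ξ s₀‖ ≤ 4 * U) {τ₁ τ₂ : ℝ}
    (hτ₁ : s₀ ≤ τ₁ ∧ 4 * U < ‖Ξ τ₁‖) (hτ₂ : s₀ ≤ τ₂ ∧ 4 * U < ‖Ξ τ₂‖) (h12 : τ₁ ≤ τ₂) :
    (3 + 4 * |α|)⁻¹ * (τ₂ - τ₁) ≤ ‖Ξ τ₂‖ - ‖Ξ τ₁‖ := by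
  set g : ℝ → ℝ := fun s => ‖Ξ s‖ with hg
  set R : Set ℝ := {τ | s₀ ≤ τ ∧ 4 * U < ‖Ξ τ‖} with hR
  have hU0 : 0 ≤ U := le_trans (norm_nonneg _) (hu s₀)
  have h0R : ∀ τ ∈ R, Ξ τ ≠ 0 := by
    intro τ hτ h; have := hτ.2; rw [h, norm_zero] at this; linarith
  -- `R` is order-connected, hence convex
  have hOC : R.OrdConnected := by
    refine ⟨fun a ha b hb c hc => ⟨le_trans ha.1 hc.1, ?_⟩⟩
    exact right_branch_up hΞ hT heq hu hs₀ ha.1 ha.2 hc.1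
  have hconv : Convex ℝ R := hOC.convex
  -- derivative data on `R`
  have hderiv : ∀ τ ∈ R, HasDerivWithinAt g (deriv g τ) R τ := fun τ hτ =>
    ((hasDerivAt_norm_curve hΞ (h0R τ hτ)).differentiableAt.hasDerivAt).hasDerivWithinAt
  have hne : ∀ τ ∈ R, deriv g τ ≠ 0 := by
    intro τ hτ h
    have hb := abs_deriv_norm_ge hΞ hT heq hu hτ.2.le (h0R τ hτ)
    rw [show (fun s => ‖Ξ s‖) = g from rfl, h, abs_zero] at hb
    have : (0 : ℝ) < (3 + 4 * |α|)⁻¹ := by positivity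
    linarith
  have hcontR : ContinuousOn g R := (hΞ.continuous.norm).continuousOn
  have hdiffR : DifferentiableOn ℝ g (interior R) := fun τ hτ =>
    (hasDerivAt_norm_curve hΞ (h0R τ (interior_subset hτ))).differentiableAt.differentiableWithinAt
  -- Darboux: constant sign
  rcases hasDerivWithinAt_forall_lt_or_forall_gt_of_forall_ne hconv hderiv hne with hneg | hpos
  · -- negative sign: `g` antitone on `R`, contradicting properness
    exfalso
    have hanti : AntitoneOn g R :=
      antitoneOn_of_deriv_nonpos hconv hcontR hdiffR fun τ hτ => (hneg τ (interior_subset hτ)).le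
    obtain ⟨τ, hτg, hτge⟩ : ∃ τ, g τ₁ < g τ ∧ τ₁ ≤ τ :=
      ((htop.eventually (eventually_gt_atTop (g τ₁))).and (eventually_ge_atTop τ₁)).exists
    have hτR : τ ∈ R := ⟨le_trans hτ₁.1 hτge, right_branch_up hΞ hT heq hu hs₀ hτ₁.1 hτ₁.2 hτge⟩
    have := hanti hτ₁ hτR hτge
    exact absurd this (not_le.2 hτg)
  · -- positive sign with the quantitative rate
    have hrate : ∀ τ ∈ interior R, (3 + 4 * |α|)⁻¹ ≤ deriv g τ := by
      intro τ hτ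
      have hτR := interior_subset hτ
      have hb := abs_deriv_norm_ge hΞ hT heq hu hτR.2.le (h0R τ hτR)
      rw [show (fun s => ‖Ξ s‖) = g from rfl, abs_of_pos (hpos τ hτR)] at hb
      exact hb
    exact hconv.mul_sub_le_image_sub_of_le_deriv hcontR hdiffR hrate τ₁ hτ₁ τ₂ hτ₂ h12

/-! ## Time reversal and the left branch -/

/-- Time reversal of the tangency relation: `s ↦ Ξ(−s)` is again a unit-speed solution, with slip
`s ↦ −w(−s)` and velocity `s ↦ u(−s)`. [folklore] -/
theorem reversal {Ξ u : ℝ → EuclideanSpace ℝ (Fin 3)} {w : ℝ → ℝ} {α : ℝ}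
    (hΞ : Differentiable ℝ Ξ) (hT : ∀ τ, ‖deriv Ξ τ‖ = 1)
    (heq : ∀ τ, u τ + (1 / 2 : ℝ) • Ξ τ - α • cross (EuclideanSpace.single (2 : Fin 3) (1 : ℝ)) (Ξ τ)
      = w τ • deriv Ξ τ) :
    Differentiable ℝ (fun s => Ξ (-s)) ∧ (∀ τ, ‖deriv (fun s => Ξ (-s)) τ‖ = 1) ∧
    (∀ τ, u (-τ) + (1 / 2 : ℝ) • Ξ (-τ) - α • cross (EuclideanSpace.single (2 : Fin 3) (1 : ℝ)) (Ξ (-τ))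
      = (-w (-τ)) • deriv (fun s => Ξ (-s)) τ) := by
  refine ⟨hΞ.comp differentiable_neg, fun τ => ?_, fun τ => ?_⟩
  · rw [deriv_comp_neg, norm_neg]; exact hT (-τ)
  · rw [deriv_comp_neg, smul_neg, neg_smul, neg_neg]; exact heq (-τ)

/-- **Left branch growth.** Before a point `s₀` of the velocity ball, on
`L = {τ | τ ≤ s₀ ∧ 4U < ‖Ξ τ‖}` the radial function DEcreases at rate `≥ (3 + 4|α|)⁻¹`:
`(3 + 4|α|)⁻¹ (τ₂ − τ₁) ≤ ‖Ξ τ₁‖ − ‖Ξ τ₂‖` for `τ₁ ≤ τ₂` in `L` (time reversal of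
`right_branch_growth`). [folklore] -/
theorem left_branch_growth {Ξ u : ℝ → EuclideanSpace ℝ (Fin 3)} {w : ℝ → ℝ} {α U : ℝ}
    (hΞ : Differentiable ℝ Ξ) (hT : ∀ τ, ‖deriv Ξ τ‖ = 1)
    (heq : ∀ τ, u τ + (1 / 2 : ℝ) • Ξ τ - α • cross (EuclideanSpace.single (2 : Fin 3) (1 : ℝ)) (Ξ τ)
      = w τ • deriv Ξ τ)
    (hu : ∀ τ, ‖u τ‖ ≤ U) (hbot : Tendsto (fun τ => ‖Ξ τ‖) atBot atTop)
    {s₀ : ℝ} (hs₀ : ‖Ξ s₀‖ ≤ 4 * U) {τ₁ τ₂ : ℝ}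
    (hτ₁ : τ₁ ≤ s₀ ∧ 4 * U < ‖Ξ τ₁‖) (hτ₂ : τ₂ ≤ s₀ ∧ 4 * U < ‖Ξ τ₂‖) (h12 : τ₁ ≤ τ₂) :
    (3 + 4 * |α|)⁻¹ * (τ₂ - τ₁) ≤ ‖Ξ τ₁‖ - ‖Ξ τ₂‖ := by
  obtain ⟨hΞ', hT', heq'⟩ := reversal hΞ hT heq
  have hu' : ∀ τ, ‖u (-τ)‖ ≤ U := fun τ => hu (-τ)
  have htop' : Tendsto (fun τ => ‖Ξ (-τ)‖) atTop atTop := hbot.comp tendsto_neg_atTop_atBot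
  have hs₀' : ‖Ξ (-(-s₀))‖ ≤ 4 * U := by rw [neg_neg]; exact hs₀
  have h := right_branch_growth (u := fun s => u (-s)) (w := fun s => -w (-s)) hΞ' hT' heq' hu' htop'
    hs₀' (τ₁ := -τ₂) (τ₂ := -τ₁)
    ⟨neg_le_neg hτ₂.1, by rw [neg_neg]; exact hτ₂.2⟩ ⟨neg_le_neg hτ₁.1, by rw [neg_neg]; exact hτ₁.2⟩
    (neg_le_neg h12)
  simp only [neg_neg] at h
  linarith

end Summit.NavierStokesRegularity.NavierStokesRegularity.Theorems.SkeletonEquilibrium.LengthRegular
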